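import Mathlib
import Literature.NumberTheory.LFunctions.KMVMollifiedMomentForms
import HarnessLib

/-!
# Kowalski–Michel–VanderKam (2000), Thm. 6.1: the Cauchy–Schwarz value WITH off-diagonal main terms,
# the «diagonal slack» `2·lin² − second`, and the beyond-diagonal tolerance `(Δ−1)/(Δ+1)` for `P = x²`

Topic `Literature/NumberTheory/LFunctions` (cell landau-siegel, LS rescue D-0124 (4): GAP-TABLE currency for the
family edge; bed node N3-A `PLFE`). E. Kowalski, P. Michel, J. VanderKam, *Non-vanishing of high derivatives of
automorphic L-functions at the center of the critical strip*, J. reine angew. Math. 526 (2000) 1–34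
[KowalskiMichelVanderKam2000], Theorem 6.1 (30)–(32), §7 p. 21. In the tree's vocabulary
(`KMVMollifiedMomentForms`: `linForm`, `secondMomentForm`, `ratio`, `envelope`): the harmonic mollified first
and second moments have main terms `lin` and `second = lin² + offDiag`, and the Cauchy–Schwarz non-vanishing
proportion at main order is `R = lin²/(2·second)`, with supremum `Δ/(2(1+Δ))` over admissible one-piece
profiles, `= 1/4` exactly at the diagonal `Δ = 1`.

What this file adds (pure algebra; the CURRENCY in which the rescue's gap table (row G-13/G-24) and the bed's
node N3-A rows state «needed vs measured» beyond the diagonal, cf. the route crux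
`Summit.Parity.GeneralizedHardyLittlewood.Theses.PrimeLevelFamEdge.BeyondDiagonalBeatsQuarter`, which asks for
`1/4 < (lin + T₁)²/(2(second + T₂))` with the true off-diagonal main terms `T₁, T₂`):

* `valueWith Δ P Q T₁ T₂ = (lin + T₁)²/(2(second + T₂))` (`valueWith … 0 0 = ratio`);
* the DIAGONAL SLACK `diagSlack Δ P Q = 2·lin² − second` and its relative form `diagSlackRel = diagSlack/second`,
  with the equivalence `1/4 < valueWith Δ P Q 0 T₂ ↔ T₂ < diagSlack Δ P Q` (for `second + T₂ > 0`) and the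
  relative version `↔ T₂/second < diagSlackRel` — «the true second-moment off-diagonal main term may exceed the
  diagonal slack» (the crux's why-it-might-fail) made quantitative; general `T₁` version `quarter_lt_valueWith_iff`;
* the ENVELOPE SLACK `envelopeSlack Δ = envelope Δ − 1/4 = (Δ−1)/(4(1+Δ))`, positive iff `Δ > 1`;
* the optimal profile `P = x²`: `lin = 2`, `second = 4 + 4/Δ`, `diagSlack = 4(Δ−1)/Δ`,
  `diagSlackRel = (Δ−1)/(Δ+1)` (`= 4·envelopeSlack Δ·…`: `envelopeSlack Δ = diagSlackRel/4 · …` see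
  `envelopeSlack_eq_quarter_mul`), and the numerals `(Δ−1)/(Δ+1) = 1/21, 1/9, 1/5` at `Δ = 11/10, 5/4, 3/2`
  (the 4.8 % / 11.1 % / 20 % tolerances of the rescue's REQSIDE U-d / bed PLFE acceptance test).

(rev 2) The EDGE sub-row: `diagSlackRel_X_sq_one_expand/_le_linear/_div` (tolerance ≤ ½(Δ−1), slope exactly ½),
the limit `tendsto_inv_add_one_half`, and the slope reading in both directions (`eventually_lt_tolerance_of_slope_lt_half`,
`eventually_tolerance_lt_of_half_lt_slope`, and in the route's currency `eventually_quarter_lt_valueWith_of_slope_lt_half` /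
`eventually_valueWith_le_quarter_of_half_lt_slope`), drafted by ls-rescue-quant-1 g2.

Nothing here asserts the moment asymptotics beyond the diagonal (OPEN IN PRINT at a fixed level) or anything
about Landau–Siegel zeros. «The programme SEARCHES and TYPES; no claim about Landau–Siegel zeros, Theorems 1–2
of arXiv:2211.02515 or a repaired Margin232 until a kernel theorem says so.»

## References

* [KowalskiMichelVanderKam2000] E. Kowalski, P. Michel, J. VanderKam, J. reine angew. Math. 526 (2000) 1–34,
  Theorem 6.1 (30)–(32), §7 p. 21. [cite: KowalskiMichelVanderKam2000, Theorem 6.1]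
-/

noncomputable section

open Polynomial

namespace Literature.NumberTheory.LFunctions.KMV2000

variable (Δ : ℝ) (P Q : ℝ[X])

/-! ## The value with off-diagonal main terms and the diagonal slack -/

/-- **The Cauchy–Schwarz value with off-diagonal main terms `T₁, T₂`**: `(lin + T₁)²/(2(second + T₂))`
(Theorem 6.1's `R(P,Q)` when the first/second moments carry extra main terms `T₁`, `T₂`; `T₁ = T₂ = 0` is the
printed diagonal range). [cite: KowalskiMichelVanderKam2000, Theorem 6.1 (30)–(32)] -/
def valueWith (T₁ T₂ : ℝ) : ℝ := (linForm Δ P Q + T₁) ^ 2 / (2 * (secondMomentForm Δ P Q + T₂))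

/-- **The diagonal slack** `2·lin² − second`: how much second-moment off-diagonal main term the profile
tolerates before its value drops to `1/4` (with `T₁ = 0`). [cite: KowalskiMichelVanderKam2000, Theorem 6.1 (31)] -/
def diagSlack : ℝ := 2 * linForm Δ P Q ^ 2 - secondMomentForm Δ P Q

/-- The relative diagonal slack `(2·lin² − second)/second`. [cite: KowalskiMichelVanderKam2000, Theorem 6.1 (31)] -/
def diagSlackRel : ℝ := diagSlack Δ P Q / secondMomentForm Δ P Q

/-- **The envelope slack** `Δ/(2(1+Δ)) − 1/4` (the optimal one-piece value minus the quarter).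
[cite: KowalskiMichelVanderKam2000, §7 p. 21] -/
def envelopeSlack (Δ : ℝ) : ℝ := envelope Δ - 1 / 4

variable {Δ P Q}

/-- With no extra main terms the value is the tree's `ratio`. [cite: KowalskiMichelVanderKam2000, Theorem 6.1] -/
theorem valueWith_zero : valueWith Δ P Q 0 0 = ratio Δ P Q := by
  simp [valueWith, ratio]

/-- **`1/4 < value ⟺ T₂ < diagonal slack`** (with `T₁ = 0`, `second + T₂ > 0`).
[cite: KowalskiMichelVanderKam2000, Theorem 6.1 (30)–(32)] -/
theorem quarter_lt_valueWith_zero_iff {T₂ : ℝ} (hpos : 0 < secondMomentForm Δ P Q + T₂) :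
    1 / 4 < valueWith Δ P Q 0 T₂ ↔ T₂ < diagSlack Δ P Q := by
  unfold valueWith diagSlack
  rw [add_zero, lt_div_iff₀ (by positivity)]
  constructor <;> intro h <;> linarith

/-- General `T₁`: `1/4 < value ⟺ T₂ < 2(lin + T₁)² − second` (`second + T₂ > 0`).
[cite: KowalskiMichelVanderKam2000, Theorem 6.1 (30)–(32)] -/
theorem quarter_lt_valueWith_iff {T₁ T₂ : ℝ} (hpos : 0 < secondMomentForm Δ P Q + T₂) :
    1 / 4 < valueWith Δ P Q T₁ T₂ ↔ T₂ < 2 * (linForm Δ P Q + T₁) ^ 2 - secondMomentForm Δ P Q := by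
  unfold valueWith
  rw [lt_div_iff₀ (by positivity)]
  constructor <;> intro h <;> linarith

/-- Relative form: for `second > 0`, `T₂ < diagSlack ⟺ T₂/second < diagSlackRel`.
[cite: KowalskiMichelVanderKam2000, Theorem 6.1 (31)] -/
theorem lt_diagSlack_iff_rel {T₂ : ℝ} (hsec : 0 < secondMomentForm Δ P Q) :
    T₂ < diagSlack Δ P Q ↔ T₂ / secondMomentForm Δ P Q < diagSlackRel Δ P Q := by
  unfold diagSlackRel
  rw [div_lt_div_iff_of_pos_right hsec]

/-- At `T₁ = T₂ = 0` the slack is positive exactly when the diagonal value beats `1/4`: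
`0 < diagSlack ⟺ 1/4 < ratio` (`second > 0`). [cite: KowalskiMichelVanderKam2000, Theorem 6.1] -/
theorem diagSlack_pos_iff (hsec : 0 < secondMomentForm Δ P Q) : 0 < diagSlack Δ P Q ↔ 1 / 4 < ratio Δ P Q := by
  rw [← valueWith_zero, quarter_lt_valueWith_zero_iff (by simpa using hsec)]

/-! ## The envelope slack -/

/-- `envelopeSlack Δ = (Δ − 1)/(4(1 + Δ))` (`Δ ≠ −1`). [cite: KowalskiMichelVanderKam2000, §7 p. 21] -/
theorem envelopeSlack_eq {Δ : ℝ} (hΔ : Δ ≠ -1) : envelopeSlack Δ = (Δ - 1) / (4 * (1 + Δ)) := by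
  unfold envelopeSlack envelope
  have h : (1 + Δ) ≠ 0 := by intro h; apply hΔ; linarith
  field_simp
  ring

/-- The envelope slack is positive exactly beyond the diagonal: `0 < envelopeSlack Δ ⟺ 1 < Δ` (`Δ ≥ 0`).
[cite: KowalskiMichelVanderKam2000, §7 p. 21] -/
theorem envelopeSlack_pos_iff {Δ : ℝ} (hΔ : 0 ≤ Δ) : 0 < envelopeSlack Δ ↔ 1 < Δ := by
  rw [envelopeSlack_eq (by linarith)]
  have h4 : 0 < 4 * (1 + Δ) := by linarith
  rw [div_pos_iff_of_pos_right h4, sub_pos]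

/-- `envelopeSlack Δ ≤ 0` on the printed range `0 ≤ Δ ≤ 1` (no admissible one-piece profile reaches beyond `1/4`
there: `ratio_one_le`). [cite: KowalskiMichelVanderKam2000, §7 p. 21] -/
theorem envelopeSlack_nonpos_of_le_one {Δ : ℝ} (hΔ : 0 ≤ Δ) (hΔ1 : Δ ≤ 1) : envelopeSlack Δ ≤ 0 := by
  rw [envelopeSlack_eq (by linarith)]
  exact div_nonpos_of_nonpos_of_nonneg (by linarith) (by linarith)

/-! ## The optimal profile `P = x²` -/

/-- `lin Δ x² 1 = 2`. [cite: KowalskiMichelVanderKam2000, §7 p. 21] -/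
theorem linForm_X_sq_one (Δ : ℝ) : linForm Δ (X ^ 2) 1 = 2 := by
  rw [linForm_one]
  simp
  norm_num

/-- `second Δ x² 1 = 4 + 4/Δ` (`∫₀¹ (x²)″² = 4`). [cite: KowalskiMichelVanderKam2000, Theorem 6.1 (31)] -/
theorem secondMomentForm_X_sq_one (Δ : ℝ) : secondMomentForm Δ (X ^ 2) 1 = 4 + 4 / Δ := by
  rw [secondMomentForm, linForm_X_sq_one, offDiagForm_one]
  have hdd : derivative (derivative (X ^ 2 : ℝ[X])) = C 2 := by
    rw [derivative_X_pow]
    simp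
  have hint : unitIntegral (derivative (derivative (X ^ 2 : ℝ[X])) ^ 2) = 4 := by
    rw [hdd, unitIntegral]
    simp only [eval_pow, eval_C, intervalIntegral.integral_const, sub_zero, smul_eq_mul]
    norm_num
  rw [hint, div_eq_inv_mul]
  ring

/-- `diagSlack Δ x² 1 = 4(Δ − 1)/Δ` (`Δ ≠ 0`). [cite: KowalskiMichelVanderKam2000, Theorem 6.1] -/
theorem diagSlack_X_sq_one {Δ : ℝ} (hΔ : Δ ≠ 0) : diagSlack Δ (X ^ 2) 1 = 4 * (Δ - 1) / Δ := by
  rw [diagSlack, linForm_X_sq_one, secondMomentForm_X_sq_one]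
  field_simp
  ring

/-- **The beyond-diagonal tolerance of the optimal profile**: `diagSlackRel Δ x² 1 = (Δ − 1)/(Δ + 1)` (`Δ > 0`) —
the largest relative second-moment off-diagonal main term `T₂/second` compatible with value `> 1/4` at length `Δ`.
[cite: KowalskiMichelVanderKam2000, Theorem 6.1] -/
theorem diagSlackRel_X_sq_one {Δ : ℝ} (hΔ : 0 < Δ) : diagSlackRel Δ (X ^ 2) 1 = (Δ - 1) / (Δ + 1) := by
  rw [diagSlackRel, diagSlack_X_sq_one hΔ.ne', secondMomentForm_X_sq_one]
  have h1 : Δ + 1 ≠ 0 := by linarith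
  field_simp

/-- The envelope slack is a quarter of the `x²`-profile's relative tolerance times `…`: precisely
`envelopeSlack Δ = (1/4)·(Δ − 1)/(Δ + 1) = diagSlackRel Δ x² 1 / 4` (`Δ > 0`). [cite: KowalskiMichelVanderKam2000, §7 p. 21] -/
theorem envelopeSlack_eq_quarter_mul {Δ : ℝ} (hΔ : 0 < Δ) : envelopeSlack Δ = diagSlackRel Δ (X ^ 2) 1 / 4 := by
  rw [diagSlackRel_X_sq_one hΔ, envelopeSlack_eq (by linarith)]
  have h1 : Δ + 1 ≠ 0 := by linarith
  have h1' : 1 + Δ ≠ 0 := by linarith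
  field_simp
  ring

/-- **The acceptance thresholds as numerals**: `(Δ−1)/(Δ+1) = 1/21, 1/9, 1/5` at `Δ = 11/10, 5/4, 3/2`
(`≈ 4.76 %`, `11.1 %`, `20 %`). [cite: KowalskiMichelVanderKam2000, Theorem 6.1] -/
theorem diagSlackRel_X_sq_numerals :
    diagSlackRel (11 / 10) (X ^ 2) 1 = 1 / 21 ∧ diagSlackRel (5 / 4) (X ^ 2) 1 = 1 / 9 ∧
      diagSlackRel (3 / 2) (X ^ 2) 1 = 1 / 5 := by
  refine ⟨?_, ?_, ?_⟩ <;> rw [diagSlackRel_X_sq_one (by norm_num)] <;> norm_num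

/-- **The K_B test in currency form for `P = x²`, `T₁ = 0`**: with a measured/assumed second-moment off-diagonal
main term `T₂` (and `4 + 4/Δ + T₂ > 0`, `Δ > 0`): `1/4 < valueWith Δ x² 1 0 T₂ ⟺ T₂/(4 + 4/Δ) < (Δ−1)/(Δ+1)`.
[cite: KowalskiMichelVanderKam2000, Theorem 6.1] -/
theorem quarter_lt_valueWith_X_sq_iff {Δ T₂ : ℝ} (hΔ : 0 < Δ) (hpos : 0 < 4 + 4 / Δ + T₂) :
    1 / 4 < valueWith Δ (X ^ 2) 1 0 T₂ ↔ T₂ / (4 + 4 / Δ) < (Δ - 1) / (Δ + 1) := by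
  have hsec : 0 < secondMomentForm Δ (X ^ 2) 1 := by rw [secondMomentForm_X_sq_one]; positivity
  rw [quarter_lt_valueWith_zero_iff (by rwa [secondMomentForm_X_sq_one]), lt_diagSlack_iff_rel hsec,
    diagSlackRel_X_sq_one hΔ, secondMomentForm_X_sq_one]

/-! ## The EDGE sub-row (rev 2): the tolerance at `Δ → 1⁺` vanishes with slope `½`; the slope READING of the
«beating windows accumulate at the diagonal» demand as a kernel fact in both directions

Drafted by ls-rescue-quant-1 g2 (scratch `FamEdgeSlope.lean` v3 74d02c55425f4229; GAP-TABLE C4′ edge sub-row, answering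
cat-3 g2 on LSR-518 `edge_of_beyondDiagonalBeatsQuarter`), re-homed here. Pure real analysis on `diagSlackRel`/`valueWith`;
the «slope shape» `T₂(Δ′)/second(Δ′) = s·(Δ′−1) + o(Δ′−1)` is the HYPOTHESIS of the theorems (a reading, not a fact).
Nothing here is a statement about L-functions. -/



/-- Exact expansion of the relative diagonal slack of `x²` at the edge: linear term `½(Δ−1)` minus a NONNEGATIVE
quadratic remainder.
[cite: KowalskiMichelVanderKam2000, Theorem 6.1] -/
theorem diagSlackRel_X_sq_one_expand {Δ : ℝ} (hΔ : 0 < Δ) :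
    diagSlackRel Δ (X ^ 2) 1 = (Δ - 1) / 2 - (Δ - 1) ^ 2 / (2 * (Δ + 1)) := by
  rw [diagSlackRel_X_sq_one hΔ]
  have h1 : Δ + 1 ≠ 0 := by linarith
  field_simp
  ring

/-- **The edge tolerance lies below its linearisation**: `diagSlackRel Δ x² 1 ≤ ½(Δ − 1)` for every `Δ > 0`
(equality only at `Δ = 1`). In words: beyond the diagonal the relative second-moment off-diagonal main term the
profile tolerates is AT MOST `½` per unit of `Δ′ − 1`.
[cite: KowalskiMichelVanderKam2000, Theorem 6.1] -/
theorem diagSlackRel_X_sq_one_le_linear {Δ : ℝ} (hΔ : 0 < Δ) :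
    diagSlackRel Δ (X ^ 2) 1 ≤ (Δ - 1) / 2 := by
  rw [diagSlackRel_X_sq_one_expand hΔ]
  have h : 0 ≤ (Δ - 1) ^ 2 / (2 * (Δ + 1)) := by positivity
  linarith

/-- The slope at the edge is exactly `½`: `diagSlackRel Δ x² 1 / (Δ − 1) = 1/(Δ + 1)` for `Δ ≠ 1`, `→ ½` as `Δ → 1`;
stated limit-free as the two-sided squeeze `1/(Δ+1) ∈ [½ − (Δ−1)/4, ½]` on `1 ≤ Δ`.
[cite: KowalskiMichelVanderKam2000, Theorem 6.1] -/
theorem diagSlackRel_X_sq_one_div {Δ : ℝ} (hΔ : 0 < Δ) (hΔ1 : Δ ≠ 1) :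
    diagSlackRel Δ (X ^ 2) 1 / (Δ - 1) = 1 / (Δ + 1) := by
  rw [diagSlackRel_X_sq_one hΔ]
  have h1 : Δ + 1 ≠ 0 := by linarith
  have h2 : Δ - 1 ≠ 0 := sub_ne_zero.mpr hΔ1
  field_simp

/-- The edge slope squeezed without limits: `½ − (Δ−1)/4 ≤ 1/(Δ+1) ≤ ½` for `1 ≤ Δ`.
[cite: KowalskiMichelVanderKam2000, Theorem 6.1] -/
theorem edge_slope_squeeze {Δ : ℝ} (hΔ1 : 1 ≤ Δ) :
    1 / 2 - (Δ - 1) / 4 ≤ 1 / (Δ + 1) ∧ 1 / (Δ + 1) ≤ 1 / 2 := by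
  have h1 : 0 < Δ + 1 := by linarith
  constructor
  · rw [show 1 / 2 - (Δ - 1) / 4 = (3 - Δ) / 4 by ring, div_le_div_iff₀ (by norm_num) h1]
    nlinarith
  · rw [div_le_div_iff₀ h1 (by norm_num)]
    linarith

/-- **K_B edge test, slope form** (frozen profile `x²`, `Q = 1`, `T₁ = 0`, `Δ > 0`, `4 + 4/Δ + T₂ > 0`): beating `¼`
at `Δ` REQUIRES the relative off-diagonal second-moment main term to be below `½(Δ − 1)`.
[cite: KowalskiMichelVanderKam2000, Theorem 6.1] -/
theorem relT₂_lt_half_linear_of_beats {Δ T₂ : ℝ} (hΔ : 0 < Δ) (hpos : 0 < 4 + 4 / Δ + T₂)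
    (hbeat : 1 / 4 < valueWith Δ (X ^ 2) 1 0 T₂) : T₂ / (4 + 4 / Δ) < (Δ - 1) / 2 := by
  have h := (quarter_lt_valueWith_X_sq_iff hΔ hpos).1 hbeat
  have h' : (Δ - 1) / (Δ + 1) = diagSlackRel Δ (X ^ 2) 1 := (diagSlackRel_X_sq_one hΔ).symm
  rw [h'] at h
  exact lt_of_lt_of_le h (diagSlackRel_X_sq_one_le_linear hΔ)

/-- The bed variable of bed3-plfe-v0.4.4/0.4.5 (value form, `rel_dR := dR/R_diag > −(Δ′−1)/(2Δ′)`): the same edge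
slope `½`, exact tolerance again inside the linear one: `(Δ−1)/(2Δ) ≤ (Δ−1)/2` for `Δ ≥ 1`, and
`(Δ−1)/(2Δ) = (Δ−1)/2 − (Δ−1)²/(2Δ)`.
[cite: KowalskiMichelVanderKam2000, Theorem 6.1] -/
theorem bedTolerance_expand {Δ : ℝ} (hΔ : 0 < Δ) :
    (Δ - 1) / (2 * Δ) = (Δ - 1) / 2 - (Δ - 1) ^ 2 / (2 * Δ) := by
  field_simp
  ring

/-- The bed-variable tolerance `(Δ−1)/(2Δ)` lies below its linearisation `½(Δ−1)` for `1 ≤ Δ`.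
[cite: KowalskiMichelVanderKam2000, Theorem 6.1] -/
theorem bedTolerance_le_linear {Δ : ℝ} (hΔ1 : 1 ≤ Δ) : (Δ - 1) / (2 * Δ) ≤ (Δ - 1) / 2 := by
  have hΔ : 0 < Δ := by linarith
  rw [bedTolerance_expand hΔ]
  have h : 0 ≤ (Δ - 1) ^ 2 / (2 * Δ) := by positivity
  linarith

/-- Numerals at the registered windows of bed3-plfe (Δ′ = 21/20, 11/10, 5/4, 7/5, 3/2): bed tolerance
`1/42, 1/22, 1/10, 1/7, 1/6` (= 2.38, 4.55, 10, 14.3, 16.7 %) vs linearised `1/40, 1/20, 1/8, 1/5, 1/4`.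
[cite: KowalskiMichelVanderKam2000, Theorem 6.1] -/
theorem bedTolerance_numerals :
    ((21 : ℝ) / 20 - 1) / (2 * (21 / 20)) = 1 / 42 ∧ ((11 : ℝ) / 10 - 1) / (2 * (11 / 10)) = 1 / 22 ∧
      ((5 : ℝ) / 4 - 1) / (2 * (5 / 4)) = 1 / 10 ∧ ((7 : ℝ) / 5 - 1) / (2 * (7 / 5)) = 1 / 7 ∧
        ((3 : ℝ) / 2 - 1) / (2 * (3 / 2)) = 1 / 6 := by
  norm_num

/-! ## The slope reading as a kernel fact (limit form, both directions)

If the relative second-moment off-diagonal main term `r(Δ′)` (`= T₂/second`) has a SLOPE at the edge,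
`r(Δ′)/(Δ′−1) → s` as `Δ′ → 1⁺`, then `s < ½` puts every `Δ′` near `1⁺` inside the tolerance (edge demand met with
room), and `½ < s` puts every `Δ′` near `1⁺` outside it (edge dead: NO beating window accumulates at `1`, contradicting
p507701 for that pair). `s = ½` is undecided at first order. The existence of the slope is the HYPOTHESIS of the
reading (no off-diagonal main term AT the diagonal); nothing typed supplies it. -/

open Filter _root_.Topology

/-- `1/(Δ+1) → ½` as `Δ → 1⁺` (the slope of the tolerance `(Δ−1)/(Δ+1)` at the edge).
[cite: KowalskiMichelVanderKam2000, Theorem 6.1] -/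
theorem tendsto_inv_add_one_half :
    Tendsto (fun Δ : ℝ => 1 / (Δ + 1)) (𝓝[>] (1 : ℝ)) (𝓝 (1 / 2)) := by
  have h : Tendsto (fun Δ : ℝ => 1 / (Δ + 1)) (𝓝 (1 : ℝ)) (𝓝 (1 / (1 + 1))) :=
    tendsto_const_nhds.div (tendsto_id.add tendsto_const_nhds) (by norm_num)
  have h2 : (1 : ℝ) / (1 + 1) = 1 / 2 := by norm_num
  rw [h2] at h
  exact h.mono_left nhdsWithin_le_nhds

/-- **Slope below ½ ⇒ inside the tolerance near the edge.**
[cite: KowalskiMichelVanderKam2000, Theorem 6.1] -/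
theorem eventually_lt_tolerance_of_slope_lt_half {r : ℝ → ℝ} {s : ℝ}
    (h : Tendsto (fun Δ => r Δ / (Δ - 1)) (𝓝[>] (1 : ℝ)) (𝓝 s)) (hs : s < 1 / 2) :
    ∀ᶠ Δ in 𝓝[>] (1 : ℝ), r Δ < (Δ - 1) / (Δ + 1) := by
  have hlim : Tendsto (fun Δ => r Δ / (Δ - 1) - 1 / (Δ + 1)) (𝓝[>] (1 : ℝ)) (𝓝 (s - 1 / 2)) :=
    h.sub tendsto_inv_add_one_half
  have hneg : ∀ᶠ Δ in 𝓝[>] (1 : ℝ), r Δ / (Δ - 1) - 1 / (Δ + 1) < 0 :=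
    hlim.eventually (gt_mem_nhds (by linarith))
  have hgt : ∀ᶠ Δ in 𝓝[>] (1 : ℝ), 1 < Δ := eventually_mem_nhdsWithin
  filter_upwards [hneg, hgt] with Δ hΔ h1
  have hpos : 0 < Δ - 1 := by linarith
  have hpos' : 0 < Δ + 1 := by linarith
  have h2 : r Δ / (Δ - 1) < 1 / (Δ + 1) := by linarith
  rw [div_lt_iff₀ hpos] at h2
  calc r Δ < 1 / (Δ + 1) * (Δ - 1) := h2
    _ = (Δ - 1) / (Δ + 1) := by field_simp

/-- **Slope above ½ ⇒ outside the tolerance near the edge** (no beating window accumulates at `1` for this pair).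
[cite: KowalskiMichelVanderKam2000, Theorem 6.1] -/
theorem eventually_tolerance_lt_of_half_lt_slope {r : ℝ → ℝ} {s : ℝ}
    (h : Tendsto (fun Δ => r Δ / (Δ - 1)) (𝓝[>] (1 : ℝ)) (𝓝 s)) (hs : 1 / 2 < s) :
    ∀ᶠ Δ in 𝓝[>] (1 : ℝ), (Δ - 1) / (Δ + 1) < r Δ := by
  have hlim : Tendsto (fun Δ => r Δ / (Δ - 1) - 1 / (Δ + 1)) (𝓝[>] (1 : ℝ)) (𝓝 (s - 1 / 2)) :=
    h.sub tendsto_inv_add_one_half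
  have hposlim : ∀ᶠ Δ in 𝓝[>] (1 : ℝ), 0 < r Δ / (Δ - 1) - 1 / (Δ + 1) :=
    hlim.eventually (lt_mem_nhds (by linarith))
  have hgt : ∀ᶠ Δ in 𝓝[>] (1 : ℝ), 1 < Δ := eventually_mem_nhdsWithin
  filter_upwards [hposlim, hgt] with Δ hΔ h1
  have hpos : 0 < Δ - 1 := by linarith
  have hpos' : 0 < Δ + 1 := by linarith
  have h2 : 1 / (Δ + 1) < r Δ / (Δ - 1) := by linarith
  rw [lt_div_iff₀ hpos] at h2
  calc (Δ - 1) / (Δ + 1) = 1 / (Δ + 1) * (Δ - 1) := by field_simp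
    _ < r Δ := h2

/-- **K_B at the edge in the route's own currency** (frozen profile `x²`, `Q = 1`, `T₁ = 0`): if the relative
second-moment off-diagonal main term `T₂(Δ′)/(4 + 4/Δ′)` has slope `s < ½` at `1⁺` (and the corrected second moment
stays positive there), then `¼ < valueWith Δ′ x² 1 0 (T₂ Δ′)` for every `Δ′` near `1⁺` — beating windows accumulate at
the diagonal, as `edge_of_beyondDiagonalBeatsQuarter` (p507701) demands.
[cite: KowalskiMichelVanderKam2000, Theorem 6.1] -/
theorem eventually_quarter_lt_valueWith_of_slope_lt_half {T₂ : ℝ → ℝ} {s : ℝ}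
    (h : Tendsto (fun Δ => T₂ Δ / (4 + 4 / Δ) / (Δ - 1)) (𝓝[>] (1 : ℝ)) (𝓝 s)) (hs : s < 1 / 2)
    (hpos : ∀ᶠ Δ in 𝓝[>] (1 : ℝ), 0 < 4 + 4 / Δ + T₂ Δ) :
    ∀ᶠ Δ in 𝓝[>] (1 : ℝ), 1 / 4 < valueWith Δ (X ^ 2) 1 0 (T₂ Δ) := by
  have hgt : ∀ᶠ Δ in 𝓝[>] (1 : ℝ), 1 < Δ := eventually_mem_nhdsWithin
  filter_upwards [eventually_lt_tolerance_of_slope_lt_half h hs, hpos, hgt] with Δ hΔ hp h1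
  exact (quarter_lt_valueWith_X_sq_iff (by linarith) hp).2 hΔ

/-- … and slope `s > ½` kills the edge for that pair: `valueWith ≤ ¼` for every `Δ′` near `1⁺`.
[cite: KowalskiMichelVanderKam2000, Theorem 6.1] -/
theorem eventually_valueWith_le_quarter_of_half_lt_slope {T₂ : ℝ → ℝ} {s : ℝ}
    (h : Tendsto (fun Δ => T₂ Δ / (4 + 4 / Δ) / (Δ - 1)) (𝓝[>] (1 : ℝ)) (𝓝 s)) (hs : 1 / 2 < s)
    (hpos : ∀ᶠ Δ in 𝓝[>] (1 : ℝ), 0 < 4 + 4 / Δ + T₂ Δ) :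
    ∀ᶠ Δ in 𝓝[>] (1 : ℝ), valueWith Δ (X ^ 2) 1 0 (T₂ Δ) ≤ 1 / 4 := by
  have hgt : ∀ᶠ Δ in 𝓝[>] (1 : ℝ), 1 < Δ := eventually_mem_nhdsWithin
  filter_upwards [eventually_tolerance_lt_of_half_lt_slope h hs, hpos, hgt] with Δ hΔ hp h1
  by_contra hc
  have hc' : 1 / 4 < valueWith Δ (X ^ 2) 1 0 (T₂ Δ) := lt_of_not_ge hc
  have := (quarter_lt_valueWith_X_sq_iff (by linarith) hp).1 hc'
  linarith

end Literature.NumberTheory.LFunctions.KMV2000
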